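import Summits.QuantumFields.YangMills.Theorems.BalabanUVNodesN15KingModelGaussianLawConvergence
import Summits.QuantumFields.YangMills.Theorems.BalabanUVNodesN15KingModelTheorem21TwoPoint
import Summits.QuantumFields.YangMills.Theorems.BalabanUVNodesN15KingModelFineFieldGeneratingFunctional

/-!
# BalabanUVNodes ∕ N15 — THE KING-MODEL RUNG (PART Ϝ-r): THE LAW OF THE BLOCK AVERAGES OF THE FINE FREE FIELD CONVERGES —
# `N(0, S₂^{(K)}) → N(0, S₂^{(∞)})` as `K → ∞` in TOTAL VARIATION on `ℝ^Ω`, with all bounded observables and all exponential moments (every unit torus, `m² > 0`)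
# (Track A, DAG node N15 = NE2; FAN-OUT v1.1 §N15 s3 «KING-MODEL RUNG … NE2's analogue DECIDED in the model»)

HONEST FRAMING.  Count-neutral (cell `pub-ymgap`, seat `pub-ymgap-dag-n15-e` g33; `--supports stmt-QuantumFields-27366 --as helper` = K3⁸
`SpineGivenEndpointR13SepCoPHV`).  TEMPLATE LITERATURE: C. King, *The U(1) Higgs model. I. The continuum limit*, Commun. Math. Phys. **102** (1986) 649–677
[King1986] — KING's OWN `A = 0`, `g = 0` MODEL.  The unit-lattice random field `Qψ` (block averages of the FREE fine field on `Ω_η`) is centred Gaussian with covariance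
`S₂^{(K)} = N^d(QB⁻¹Qᵀ)` (part Ϝ-d: the Hessian of King's generating functional at block sources); King's block field `ψ_K` is `Qψ` plus the white noise of (2.15) (part
Ϝ package).  Here the law of `Qψ` ITSELF — the Gaussian density with precision `P_K = (S₂^{(K)})⁻¹` — is shown to converge to the Gaussian with precision `(S₂^{(∞)})⁻¹`
(part Ϝ-q's generic engine): the free field's block averages have a continuum limit as a random field on the unit lattice.  Parts Ϡ-k∕Ϡ-m did the same for the RG block
field (precision `Δ^{(K)}`).  NOT the interacting model; NOT Bałaban's objects; NOT a node discharge (N15 is booked through n15-a's knit, untouched here); nothing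
continuum-Yang–Mills ∕ ℝ⁴ ∕ OS ∕ mass-gap ∕ Clay.  0 `sorry`; standard axioms; THREE definitions (`s2Floor`, `fineBlockPrec`, `fineBlockPrecLim`).

THE MATHEMATICS.  UNIFORM COERCIVITY of the covariances: the central alias term gives `S_N(q) ≥ s₀ := (4∕π²)^{d+1}∕(m² + (d+1)π²)` (`|u(z_q)|² ≥ (4∕π²)^{d+1}`, `σ(z_q) ≤ m² +
(d+1)π²` since `|θ_μ(z_q)| ≤ π∕N`), and `S_∞ ≥ s₀` in the limit; with `S ≤ m⁻²` (parts Ϝ-a∕Ϝ-b) the forms satisfy `s₀|J|² ≤ ΣJS₂J ≤ m⁻²|J|²`.  Hence the PRECISIONS `P = S₂⁻¹`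
satisfy `m²|x|² ≤ ⟨x,Px⟩ ≤ s₀⁻¹|x|²` (the lower bound by Cauchy–Schwarz in the `S₂`-inner product; the upper by coercivity), uniformly in `K`; the precisions converge in every
quadratic form (entrywise convergence of `S₂^{(K)}`, part Ϝ-d, and continuity of matrix inversion at the invertible `S₂^{(∞)}`); part Ϝ-q's engine then gives `𝒩(P_K) → 𝒩(P_∞)`,
pointwise and total-variation convergence of the densities, all bounded observables, and all exponential moments — the latter being `exp(½⟨J,S₂^{(K)}J⟩) = Z_η(Ω, J∘blk)`
(part Ϝ-a), consistent with part Ϝ-b.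

WHAT THIS FILE PROVES (kernel).  §0 letters: `dot_of_mulVec`, `form_cauchy_schwarz` (PSD symmetric forms), ★ `dot_inv_mulVec_ge_of_form_le`.  §1 `s2Floor`, `s2Floor_pos`, `lapSym_z_le`,
★ `Sfib_ge_floor`, `aliasSeries0_sOf_ge_floor`, ★ `coercive_kingS2`, `coercive_kingS2Lim`, `kingS2_matrix_form_le`, `kingS2Lim_matrix_form_le`, symmetry.  §2 `fineBlockPrec`,
`fineBlockPrecLim`, ★ `coercive_fineBlockPrec(_Lim)` (`≥ m²`), `fineBlockPrec_form_le` (`≤ s₀⁻¹`), `tendsto_form_kingS2`, ★★ `tendsto_form_fineBlockPrec`.  §3 ★★ `tendsto_gaussNorm_fineBlockPrec`,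
★★★ **`tendsto_tv_fineBlockLaw`**, ★★★ **`tendsto_observable_fineBlockLaw`**, ★★★ **`tendsto_mgf_fineBlockLaw`**, ★★ `mgf_fineBlockLaw_eq_kingFineZ` (the MGF IS King's functional at `J∘blk`).

HONEST SCOPE.  Free field; block averages on the unit lattice; odd `L ≥ 3` de facto, `m² > 0`.  N15 untouched; counts unmoved.
Locators: [King1986] (2.4)–(2.6) p.652, (2.13)–(2.15) p.653, Thm 2.1 (2.22) p.654, (4.5) p.670, (4.14) p.671, (4.35)–(4.36) p.674.
-/

noncomputable section

open scoped BigOperators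
open Finset Matrix Filter Topology MeasureTheory

namespace Summit.QuantumFields.YangMills.BalabanUVNodes.N15KingModelRung

open Literature.MathematicalPhysics.QuantumFieldTheory.Balaban1983to89.B5Prop11Plancherel (Tor fine chi sOf)
open Literature.MathematicalPhysics.QuantumFieldTheory.Balaban1983to89.QGQInverse (Coercive isUnit_of_coercive)
open Literature.MathematicalPhysics.QuantumFieldTheory.King1986 (aK)
open Literature.MathematicalPhysics.QuantumFieldTheory.King1986.Torus
open FreeField

variable {d : ℕ}

/-! ## §0 Letters -/

section Letters

variable {ι : Type*} [Fintype ι] [DecidableEq ι]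

omit [DecidableEq ι] in
/-- `⟨x, (of f)y⟩ = Σ_b Σ_{b′} x_b f(b,b′) y_{b′}`. [folklore] -/
theorem dot_of_mulVec (f : ι → ι → ℝ) (x y : ι → ℝ) : x ⬝ᵥ (Matrix.of f *ᵥ y) = ∑ b, ∑ b', x b * f b b' * y b' := by
  simp only [dotProduct, Matrix.mulVec, Matrix.of_apply, Finset.mul_sum]
  exact Finset.sum_congr rfl fun b _ => Finset.sum_congr rfl fun b' _ => by ring

omit [DecidableEq ι] in
/-- Cauchy–Schwarz for the semi-inner product of a symmetric positive semidefinite real matrix: `⟨a,Sb⟩² ≤ ⟨a,Sa⟩⟨b,Sb⟩`. [folklore] -/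
theorem form_cauchy_schwarz {S : Matrix ι ι ℝ} (hsymm : Sᵀ = S) (hpsd : ∀ v, 0 ≤ v ⬝ᵥ (S *ᵥ v)) (a b : ι → ℝ) :
    (a ⬝ᵥ (S *ᵥ b)) ^ 2 ≤ (a ⬝ᵥ (S *ᵥ a)) * (b ⬝ᵥ (S *ᵥ b)) := by
  have hab : b ⬝ᵥ (S *ᵥ a) = a ⬝ᵥ (S *ᵥ b) := by
    rw [Matrix.dotProduct_mulVec, ← Matrix.mulVec_transpose, hsymm, dotProduct_comm]
  have hquad : ∀ t : ℝ, 0 ≤ (b ⬝ᵥ (S *ᵥ b)) * (t * t) + (2 * (a ⬝ᵥ (S *ᵥ b))) * t + a ⬝ᵥ (S *ᵥ a) := by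
    intro t
    have h := hpsd (a + t • b)
    simp only [Matrix.mulVec_add, Matrix.mulVec_smul, add_dotProduct, dotProduct_add, smul_dotProduct, dotProduct_smul, smul_eq_mul, hab] at h
    nlinarith [h]
  have hd := discrim_le_zero hquad
  rw [discrim] at hd
  nlinarith

/-- ★ **THE INVERSE OF A BOUNDED POSITIVE FORM IS COERCIVE**: if `S` is symmetric, `0 ≤ ⟨v,Sv⟩ ≤ Λ|v|²` and `S` is a unit, then `⟨x, S⁻¹x⟩ ≥ Λ⁻¹|x|²`. [folklore] -/
theorem dot_inv_mulVec_ge_of_form_le {S : Matrix ι ι ℝ} (hsymm : Sᵀ = S) (hpsd : ∀ v, 0 ≤ v ⬝ᵥ (S *ᵥ v)) {Λ : ℝ} (hΛ : 0 < Λ)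
    (hup : ∀ v, v ⬝ᵥ (S *ᵥ v) ≤ Λ * (v ⬝ᵥ v)) (hunit : IsUnit S.det) (x : ι → ℝ) :
    Λ⁻¹ * (x ⬝ᵥ x) ≤ x ⬝ᵥ (S⁻¹ *ᵥ x) := by
  set y := S⁻¹ *ᵥ x with hy
  have hSy : S *ᵥ y = x := by rw [hy, Matrix.mulVec_mulVec, Matrix.mul_nonsing_inv S hunit, Matrix.one_mulVec]
  -- `A = ⟨x, y⟩ = ⟨y, Sy⟩ ≥ 0`
  have hA : y ⬝ᵥ (S *ᵥ y) = x ⬝ᵥ y := by rw [Matrix.dotProduct_mulVec, ← Matrix.mulVec_transpose, hsymm, hSy]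
  have hA0 : 0 ≤ x ⬝ᵥ y := by rw [← hA]; exact hpsd y
  -- `⟨y, Sx⟩ = |x|²`
  have hyx : y ⬝ᵥ (S *ᵥ x) = x ⬝ᵥ x := by rw [Matrix.dotProduct_mulVec, ← Matrix.mulVec_transpose, hsymm, hSy]
  -- Cauchy–Schwarz in the `S`-form with `(y, Sy) = (y, x)`
  have hcs := form_cauchy_schwarz hsymm hpsd y (S *ᵥ y)
  rw [hSy, hyx, dotProduct_comm y x] at hcs
  have hup' := hup x
  have hxx0 : 0 ≤ x ⬝ᵥ x := Literature.LinearAlgebra.Matrix.dotProduct_self_nonneg_real x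
  have h1 : (x ⬝ᵥ x) ^ 2 ≤ (x ⬝ᵥ y) * (Λ * (x ⬝ᵥ x)) := hcs.trans (mul_le_mul_of_nonneg_left hup' hA0)
  rcases hxx0.eq_or_lt with h0 | hpos
  · rw [← h0, mul_zero]; exact hA0
  · have h2 : x ⬝ᵥ x ≤ Λ * (x ⬝ᵥ y) := by nlinarith
    calc Λ⁻¹ * (x ⬝ᵥ x) ≤ Λ⁻¹ * (Λ * (x ⬝ᵥ y)) := by gcongr
      _ = x ⬝ᵥ y := by field_simp

end Letters

/-! ## §1 Uniform coercivity of the Schwinger covariances -/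

section Floor

variable (L : ℕ) (M : Fin (d + 1) → ℕ) [hM : ∀ ν, NeZero (M ν)]

/-- The uniform floor `s₀ = (4∕π²)^{d+1}∕(m² + (d+1)π²)` of the alias sums. [cite: King1986, (4.5) p.670, (4.14) p.671] -/
def s2Floor (d : ℕ) (m2 : ℝ) : ℝ := (4 / Real.pi ^ 2) ^ (d + 1) / (m2 + (d + 1) * Real.pi ^ 2)

omit hM in
/-- `s₀ > 0`. [folklore] -/
theorem s2Floor_pos {m2 : ℝ} (hm : 0 < m2) : 0 < s2Floor d m2 := by unfold s2Floor; positivity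

/-- `σ(z_q) ≤ m² + (d+1)π²` for the central fine momentum above `q` (`|θ_μ(z_q)| ≤ π∕N`, `2 − 2cos θ ≤ θ²`). [cite: King1986, (4.4) p.670] -/
theorem lapSym_z_le (N : ℕ) [NeZero N] (m2 : ℝ) (q : Tor M) :
    lapSym (fine N M) ((N : ℝ) ^ 2) m2 (z N M q) ≤ m2 + (d + 1) * Real.pi ^ 2 := by
  have hN : (1 : ℝ) ≤ N := by exact_mod_cast Nat.one_le_iff_ne_zero.mpr (NeZero.ne N)
  have hNpos : (0 : ℝ) < N := by linarith
  unfold lapSym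
  have hterm : ∀ μ, (N : ℝ) ^ 2 * (2 - 2 * Real.cos (sOf (fine N M) (z N M q) μ)) ≤ Real.pi ^ 2 := by
    intro μ
    have hθ := abs_sOf_z_le N M q μ
    have hcos := Real.one_sub_sq_div_two_le_cos (x := sOf (fine N M) (z N M q) μ)
    have hsq : (sOf (fine N M) (z N M q) μ) ^ 2 ≤ (Real.pi / N) ^ 2 := by
      rw [← sq_abs]; exact pow_le_pow_left₀ (abs_nonneg _) hθ 2
    have h1 : (N : ℝ) ^ 2 * (2 - 2 * Real.cos (sOf (fine N M) (z N M q) μ)) ≤ (N : ℝ) ^ 2 * (sOf (fine N M) (z N M q) μ) ^ 2 :=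
      mul_le_mul_of_nonneg_left (by linarith) (by positivity)
    calc _ ≤ (N : ℝ) ^ 2 * (Real.pi / N) ^ 2 := h1.trans (mul_le_mul_of_nonneg_left hsq (by positivity))
      _ = Real.pi ^ 2 := by field_simp
  rw [Finset.mul_sum]
  calc m2 + ∑ μ, (N : ℝ) ^ 2 * (2 - 2 * Real.cos (sOf (fine N M) (z N M q) μ)) ≤ m2 + ∑ _μ : Fin (d + 1), Real.pi ^ 2 := by
        gcongr with μ _; exact hterm μ
    _ = m2 + (d + 1) * Real.pi ^ 2 := by rw [Finset.sum_const, Finset.card_univ, Fintype.card_fin, nsmul_eq_mul]; push_cast; ring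

/-- ★ **THE UNIFORM FLOOR**: `S_N(q) ≥ s₀` for every `N ≥ 1`, every unit torus, every `q` (the central alias term alone). [cite: King1986, (4.5) p.670, (4.14) p.671] -/
theorem Sfib_ge_floor (N : ℕ) [NeZero N] {m2 : ℝ} (hm : 0 < m2) (q : Tor M) : s2Floor d m2 ≤ Sfib N M ((N : ℝ) ^ 2) m2 q := by
  have hN1 : 1 ≤ N := Nat.one_le_iff_ne_zero.mpr (NeZero.ne N)
  have hlap0 : 0 < lapSym (fine N M) ((N : ℝ) ^ 2) m2 (z N M q) := lt_of_lt_of_le hm (lapSym_ge (fine N M) _ m2 (by positivity) _)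
  have hcentral : s2Floor d m2 ≤ ‖u N M (z N M q)‖ ^ 2 / lapSym (fine N M) ((N : ℝ) ^ 2) m2 (z N M q) := by
    unfold s2Floor
    have hu := norm_sq_u_central N M hN1 q
    have hσ := lapSym_z_le M N m2 q
    have hpos : 0 < m2 + (d + 1) * Real.pi ^ 2 := by positivity
    rw [div_le_div_iff₀ hpos hlap0]
    calc (4 / Real.pi ^ 2) ^ (d + 1) * lapSym (fine N M) ((N : ℝ) ^ 2) m2 (z N M q)
        ≤ (4 / Real.pi ^ 2) ^ (d + 1) * (m2 + (d + 1) * Real.pi ^ 2) := mul_le_mul_of_nonneg_left hσ (by positivity)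
      _ ≤ ‖u N M (z N M q)‖ ^ 2 * (m2 + (d + 1) * Real.pi ^ 2) := mul_le_mul_of_nonneg_right hu hpos.le
  refine hcentral.trans ?_
  unfold Sfib
  exact Finset.single_le_sum (f := fun p => ‖u N M p‖ ^ 2 / lapSym (fine N M) ((N : ℝ) ^ 2) m2 p)
    (fun p _ => div_nonneg (sq_nonneg _) (le_trans hm.le (lapSym_ge (fine N M) _ m2 (by positivity) _))) (z_mem_fib N M q)

/-- `S_∞(p′(q)) ≥ s₀` (the limit of the floor, odd `L ≥ 2`). [cite: King1986, (4.5) p.670] -/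
theorem aliasSeries0_sOf_ge_floor (hLodd : Odd L) (hL : 2 ≤ L) {m2 : ℝ} (hm : 0 < m2) (q : Tor M) : s2Floor d m2 ≤ aliasSeries0 m2 (sOf M q) := by
  haveI : NeZero L := ⟨by omega⟩
  exact ge_of_tendsto (tendsto_Sfib_pow L M hLodd hL hm q) (Filter.Eventually.of_forall fun K => Sfib_ge_floor M (L ^ K) hm q)

/-- ★ **`S₂^{(K)}` IS COERCIVE WITH THE UNIFORM CONSTANT `s₀`** (as a matrix on the unit lattice). [cite: King1986, (4.5) p.670, (4.35) p.674] -/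
theorem coercive_kingS2 (N : ℕ) [NeZero N] {m2 : ℝ} (hm : 0 < m2) : Coercive (Matrix.of (kingS2 N M m2)) (s2Floor d m2) := by
  intro J
  have hcard : (0 : ℝ) < Fintype.card (Tor M) := by exact_mod_cast Fintype.card_pos
  rw [dot_of_mulVec, kingS2_form_eq, blockAvg_form N M (by positivity) hm J]
  calc s2Floor d m2 * (J ⬝ᵥ J) = (Fintype.card (Tor M) : ℝ)⁻¹ * ∑ q : Tor M, s2Floor d m2 * ‖ft M J q‖ ^ 2 := by
        rw [← Finset.mul_sum, ← parseval_dot]; field_simp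
    _ ≤ (Fintype.card (Tor M) : ℝ)⁻¹ * ∑ q : Tor M, Sfib N M ((N : ℝ) ^ 2) m2 q * ‖ft M J q‖ ^ 2 := by
        gcongr with q _; exact Sfib_ge_floor M N hm q

/-- `S₂^{(∞)}` is coercive with `s₀`. [cite: King1986, (4.5) p.670] -/
theorem coercive_kingS2Lim (hLodd : Odd L) (hL : 2 ≤ L) {m2 : ℝ} (hm : 0 < m2) : Coercive (Matrix.of (kingS2Lim M m2)) (s2Floor d m2) := by
  intro J
  have hcard : (0 : ℝ) < Fintype.card (Tor M) := by exact_mod_cast Fintype.card_pos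
  rw [dot_of_mulVec, kingS2Lim_form_eq L M hLodd hL one_pos hm J]
  calc s2Floor d m2 * (J ⬝ᵥ J) = (Fintype.card (Tor M) : ℝ)⁻¹ * ∑ q : Tor M, s2Floor d m2 * ‖ft M J q‖ ^ 2 := by
        rw [← Finset.mul_sum, ← parseval_dot]; field_simp
    _ ≤ (Fintype.card (Tor M) : ℝ)⁻¹ * ∑ q : Tor M, aliasSeries0 m2 (sOf M q) * ‖ft M J q‖ ^ 2 := by
        gcongr with q _; exact aliasSeries0_sOf_ge_floor L M hLodd hL hm q

/-- `⟨J, S₂^{(K)}J⟩ ≤ m⁻²|J|²`. [cite: King1986, (4.8) p.671] -/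
theorem kingS2_matrix_form_le (N : ℕ) [NeZero N] {m2 : ℝ} (hm : 0 < m2) (J : Tor M → ℝ) : J ⬝ᵥ (Matrix.of (kingS2 N M m2) *ᵥ J) ≤ m2⁻¹ * (J ⬝ᵥ J) := by
  rw [dot_of_mulVec]; exact kingS2_form_le N M hm J

/-- `⟨J, S₂^{(∞)}J⟩ ≤ m⁻²|J|²`. [cite: King1986, (4.8) p.671] -/
theorem kingS2Lim_matrix_form_le (hLodd : Odd L) (hL : 2 ≤ L) {m2 : ℝ} (hm : 0 < m2) (J : Tor M → ℝ) :
    J ⬝ᵥ (Matrix.of (kingS2Lim M m2) *ᵥ J) ≤ m2⁻¹ * (J ⬝ᵥ J) := by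
  rw [dot_of_mulVec]; exact kingS2Lim_form_le L M hLodd hL hm J

/-- `S₂^{(K)}` is symmetric as a matrix. [folklore] -/
theorem kingS2_matrix_transpose (N : ℕ) [NeZero N] (m2 : ℝ) : (Matrix.of (kingS2 N M m2))ᵀ = Matrix.of (kingS2 N M m2) := by
  ext b b'; simp only [Matrix.transpose_apply, Matrix.of_apply]; exact kingS2_symm N M m2 b' b

omit hM in
/-- `S₂^{(∞)}` is symmetric as a matrix. [folklore] -/
theorem kingS2Lim_matrix_transpose (M : Fin (d + 1) → ℕ) [∀ ν, NeZero (M ν)] (m2 : ℝ) : (Matrix.of (kingS2Lim M m2))ᵀ = Matrix.of (kingS2Lim M m2) := by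
  ext b b'; simp only [Matrix.transpose_apply, Matrix.of_apply]; exact kingS2Lim_symm M m2 b' b

end Floor

/-! ## §2 The precisions: coercivity, ceiling, convergence -/

section Precision

variable (L : ℕ) (M : Fin (d + 1) → ℕ) [hM : ∀ ν, NeZero (M ν)]

/-- The precision of the block averages of the fine free field at level `K`: `P_K = (S₂^{(K)})⁻¹`. [cite: King1986, (2.6) p.652, (2.13) p.653] -/
def fineBlockPrec (N : ℕ) [NeZero N] (m2 : ℝ) : Matrix (Tor M) (Tor M) ℝ := (Matrix.of (kingS2 N M m2))⁻¹

/-- The limit precision `P_∞ = (S₂^{(∞)})⁻¹`. [cite: King1986, (2.6) p.652] -/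
def fineBlockPrecLim (m2 : ℝ) : Matrix (Tor M) (Tor M) ℝ := (Matrix.of (kingS2Lim M m2))⁻¹

/-- ★ `P_K ≥ m²`, uniformly in `K` (inverse of a form bounded by `m⁻²`). [cite: King1986, (4.8) p.671] -/
theorem coercive_fineBlockPrec (N : ℕ) [NeZero N] {m2 : ℝ} (hm : 0 < m2) : Coercive (fineBlockPrec M N m2) m2 := by
  intro x
  have hco := coercive_kingS2 M N hm
  have h := dot_inv_mulVec_ge_of_form_le (kingS2_matrix_transpose M N m2) (fun v => le_trans (mul_nonneg (s2Floor_pos hm).le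
    (Literature.LinearAlgebra.Matrix.dotProduct_self_nonneg_real v)) (hco v)) (inv_pos.mpr hm) (kingS2_matrix_form_le M N hm)
    ((Matrix.isUnit_iff_isUnit_det _).mp (isUnit_of_coercive (s2Floor_pos hm) hco)) x
  rwa [inv_inv] at h

/-- `P_∞ ≥ m²`. [cite: King1986, (4.8) p.671] -/
theorem coercive_fineBlockPrecLim (hLodd : Odd L) (hL : 2 ≤ L) {m2 : ℝ} (hm : 0 < m2) : Coercive (fineBlockPrecLim M m2) m2 := by
  intro x
  have hco := coercive_kingS2Lim L M hLodd hL hm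
  have h := dot_inv_mulVec_ge_of_form_le (kingS2Lim_matrix_transpose M m2) (fun v => le_trans (mul_nonneg (s2Floor_pos hm).le
    (Literature.LinearAlgebra.Matrix.dotProduct_self_nonneg_real v)) (hco v)) (inv_pos.mpr hm) (kingS2Lim_matrix_form_le L M hLodd hL hm)
    ((Matrix.isUnit_iff_isUnit_det _).mp (isUnit_of_coercive (s2Floor_pos hm) hco)) x
  rwa [inv_inv] at h

/-- The ceiling: `⟨x, P_Kx⟩ ≤ s₀⁻¹|x|²` (coercivity of `S₂^{(K)}`). [cite: King1986, (4.5) p.670] -/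
theorem fineBlockPrec_form_le (N : ℕ) [NeZero N] {m2 : ℝ} (hm : 0 < m2) (x : Tor M → ℝ) :
    x ⬝ᵥ (fineBlockPrec M N m2 *ᵥ x) ≤ (s2Floor d m2)⁻¹ * (x ⬝ᵥ x) :=
  dot_inv_mulVec_le_of_coercive (s2Floor_pos hm) (coercive_kingS2 M N hm) x

/-- The quadratic forms of `S₂^{(K)}` converge (entrywise convergence, part Ϝ-d). [cite: King1986, Thm 2.1 (2.22) p.654] -/
theorem tendsto_form_kingS2 (hLodd : Odd L) (hL : 2 ≤ L) {m2 : ℝ} (hm : 0 < m2) (x : Tor M → ℝ) :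
    haveI : NeZero L := ⟨by omega⟩
    Tendsto (fun K : ℕ => x ⬝ᵥ (Matrix.of (kingS2 (L ^ K) M m2) *ᵥ x)) atTop (𝓝 (x ⬝ᵥ (Matrix.of (kingS2Lim M m2) *ᵥ x))) := by
  haveI : NeZero L := ⟨by omega⟩
  simp only [dot_of_mulVec]
  refine tendsto_finsetSum _ fun b _ => tendsto_finsetSum _ fun b' _ => ?_
  exact ((tendsto_kingS2 L M hLodd hL hm b b').const_mul _).mul_const _

/-- ★★ **THE PRECISIONS CONVERGE IN EVERY QUADRATIC FORM**: `⟨x, P_Kx⟩ → ⟨x, P_∞x⟩` (continuity of inversion at the invertible `S₂^{(∞)}`). [cite: King1986, Thm 2.1 (2.22) p.654] -/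
theorem tendsto_form_fineBlockPrec (hLodd : Odd L) (hL : 2 ≤ L) {m2 : ℝ} (hm : 0 < m2) (x : Tor M → ℝ) :
    haveI : NeZero L := ⟨by omega⟩
    Tendsto (fun K : ℕ => x ⬝ᵥ (fineBlockPrec M (L ^ K) m2 *ᵥ x)) atTop (𝓝 (x ⬝ᵥ (fineBlockPrecLim M m2 *ᵥ x))) := by
  haveI : NeZero L := ⟨by omega⟩
  unfold fineBlockPrec fineBlockPrecLim
  exact tendsto_inv_form_of_forms (A := fun K : ℕ => Matrix.of (kingS2 (L ^ K) M m2)) (s2Floor_pos hm) (coercive_kingS2Lim L M hLodd hL hm)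
    (fun K => kingS2_matrix_transpose M (L ^ K) m2) (kingS2Lim_matrix_transpose M m2) (tendsto_form_kingS2 L M hLodd hL hm) x

/-- Symmetry of the precisions. [folklore] -/
theorem fineBlockPrec_transpose (N : ℕ) [NeZero N] (m2 : ℝ) : (fineBlockPrec M N m2)ᵀ = fineBlockPrec M N m2 := by
  unfold fineBlockPrec; rw [Matrix.transpose_nonsing_inv, kingS2_matrix_transpose]

omit hM in
/-- Symmetry of the limit precision. [folklore] -/
theorem fineBlockPrecLim_transpose (M : Fin (d + 1) → ℕ) [∀ ν, NeZero (M ν)] (m2 : ℝ) : (fineBlockPrecLim M m2)ᵀ = fineBlockPrecLim M m2 := by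
  unfold fineBlockPrecLim; rw [Matrix.transpose_nonsing_inv, kingS2Lim_matrix_transpose]

end Precision

/-! ## §3 The law of the block averages converges -/

section Law

variable (L : ℕ) (M : Fin (d + 1) → ℕ) [hM : ∀ ν, NeZero (M ν)]

/-- ★★ `𝒩(P_K) → 𝒩(P_∞)`. [cite: King1986, (2.6) p.652] -/
theorem tendsto_gaussNorm_fineBlockPrec (hLodd : Odd L) (hL : 2 ≤ L) {m2 : ℝ} (hm : 0 < m2) :
    haveI : NeZero L := ⟨by omega⟩
    Tendsto (fun K : ℕ => gaussNorm (fineBlockPrec M (L ^ K) m2)) atTop (𝓝 (gaussNorm (fineBlockPrecLim M m2))) := by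
  haveI : NeZero L := ⟨by omega⟩
  exact tendsto_gaussNorm_of_forms (A := fun K : ℕ => fineBlockPrec M (L ^ K) m2) hm (fun K => coercive_fineBlockPrec M (L ^ K) hm)
    (tendsto_form_fineBlockPrec L M hLodd hL hm)

/-- ★★★ **THE LAWS OF THE BLOCK AVERAGES OF THE FINE FREE FIELD CONVERGE IN TOTAL VARIATION**: `∫|ρ_{P_K} − ρ_{P_∞}| → 0` as `K → ∞` (odd `L ≥ 2`, `m² > 0`, every unit torus).
[cite: King1986, Thm 2.1 (2.22) p.654, (2.6) p.652] -/
theorem tendsto_tv_fineBlockLaw (hLodd : Odd L) (hL : 2 ≤ L) {m2 : ℝ} (hm : 0 < m2) :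
    haveI : NeZero L := ⟨by omega⟩
    Tendsto (fun K : ℕ => ∫ x, |gaussDensity (fineBlockPrec M (L ^ K) m2) x - gaussDensity (fineBlockPrecLim M m2) x|) atTop (𝓝 0) := by
  haveI : NeZero L := ⟨by omega⟩
  exact tendsto_integral_abs_gaussDensity_sub_of_forms (A := fun K : ℕ => fineBlockPrec M (L ^ K) m2) hm (fun K => coercive_fineBlockPrec M (L ^ K) hm)
    (coercive_fineBlockPrecLim L M hLodd hL hm) (inv_pos.mpr (s2Floor_pos hm)) (fun K x => fineBlockPrec_form_le M (L ^ K) hm x)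
    (tendsto_form_fineBlockPrec L M hLodd hL hm)

/-- ★★★ **EVERY BOUNDED OBSERVABLE OF THE BLOCK AVERAGES CONVERGES**: `∫Fρ_{P_K} → ∫Fρ_{P_∞}` (`|F| ≤ C`, a.e.-strongly measurable). [cite: King1986, Thm 2.1 (2.22) p.654] -/
theorem tendsto_observable_fineBlockLaw (hLodd : Odd L) (hL : 2 ≤ L) {m2 : ℝ} (hm : 0 < m2) {F : (Tor M → ℝ) → ℝ} {C : ℝ}
    (hF : AEStronglyMeasurable F volume) (hFC : ∀ x, |F x| ≤ C) :
    haveI : NeZero L := ⟨by omega⟩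
    Tendsto (fun K : ℕ => ∫ x, F x * gaussDensity (fineBlockPrec M (L ^ K) m2) x) atTop (𝓝 (∫ x, F x * gaussDensity (fineBlockPrecLim M m2) x)) := by
  haveI : NeZero L := ⟨by omega⟩
  exact tendsto_integral_observable_of_forms (A := fun K : ℕ => fineBlockPrec M (L ^ K) m2) hm (fun K => coercive_fineBlockPrec M (L ^ K) hm)
    (coercive_fineBlockPrecLim L M hLodd hL hm) (inv_pos.mpr (s2Floor_pos hm)) (fun K x => fineBlockPrec_form_le M (L ^ K) hm x)
    (tendsto_form_fineBlockPrec L M hLodd hL hm) hF hFC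

/-- ★★★ **ALL EXPONENTIAL MOMENTS CONVERGE**: `∫e^{⟨J,x⟩}ρ_{P_K} → ∫e^{⟨J,x⟩}ρ_{P_∞}`. [cite: King1986, (2.6) p.652, Thm 2.1 (2.22) p.654] -/
theorem tendsto_mgf_fineBlockLaw (hLodd : Odd L) (hL : 2 ≤ L) {m2 : ℝ} (hm : 0 < m2) (J : Tor M → ℝ) :
    haveI : NeZero L := ⟨by omega⟩
    Tendsto (fun K : ℕ => ∫ x, Real.exp (J ⬝ᵥ x) * gaussDensity (fineBlockPrec M (L ^ K) m2) x) atTop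
      (𝓝 (∫ x, Real.exp (J ⬝ᵥ x) * gaussDensity (fineBlockPrecLim M m2) x)) := by
  haveI : NeZero L := ⟨by omega⟩
  exact tendsto_mgf_of_forms (A := fun K : ℕ => fineBlockPrec M (L ^ K) m2) hm (fun K => coercive_fineBlockPrec M (L ^ K) hm)
    (coercive_fineBlockPrecLim L M hLodd hL hm) (fun K => fineBlockPrec_transpose M (L ^ K) m2) (fineBlockPrecLim_transpose M m2)
    (tendsto_form_fineBlockPrec L M hLodd hL hm) J

/-- ★★ **THE MGF OF THE BLOCK-AVERAGE LAW IS KING's FUNCTIONAL AT THE BLOCK SOURCE**: `∫e^{⟨J,x⟩}ρ_{P_K} = Z_η(Ω, J∘blk)` (`P_K⁻¹ = S₂^{(K)}`; parts Ϝ-a∕Ϝ-d).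
[cite: King1986, (2.6) p.652, Thm 2.1 (2.22) p.654] -/
theorem mgf_fineBlockLaw_eq_kingFineZ (N : ℕ) [NeZero N] {m2 : ℝ} (hm : 0 < m2) (J : Tor M → ℝ) :
    ∫ x, Real.exp (J ⬝ᵥ x) * gaussDensity (fineBlockPrec M N m2) x = kingFineZ N M m2 (blockSrc N M J) := by
  have hunit : IsUnit (Matrix.of (kingS2 N M m2)).det := (Matrix.isUnit_iff_isUnit_det _).mp (isUnit_of_coercive (s2Floor_pos hm) (coercive_kingS2 M N hm))
  simp only [gaussDensity]
  rw [integral_exp_dot_gaussDensity hm (coercive_fineBlockPrec M N hm) (fineBlockPrec_transpose M N m2), fineBlockPrec, Matrix.nonsing_inv_nonsing_inv _ hunit,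
    kingFineZ_blockSrc_eq N M hm, dot_of_mulVec, kingS2_form_eq]

end Law

end Summit.QuantumFields.YangMills.BalabanUVNodes.N15KingModelRung

end
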